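import Mathlib
import Summits.QuantumAdvantage.QuantumAdvantage.Theses.MobiusLadder

/-!
# Route `MobiusLadder`: the crux `DigitPolyUniformity` (stmt-QuantumAdvantage-1392) CONTAINS the crux
# `QuadraticDigitPhases` (stmt-QuantumAdvantage-1391)

The route files both rungs-R1 cruxes separately: `QuadraticDigitPhases` (λ is asymptotically orthogonal
to every QUADRATIC `𝔽₂`-phase of the binary digits) and `DigitPolyUniformity` (the same for every phase
of total degree `≤ (log₂ n)^A`, for every `A`). Since `2 ≤ log₂ n` as soon as `n ≥ 4`, the second
contains the first (take `A = 1`). This file records that containment as a theorem, so that the ledger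
sees the dependency the planners state informally ("1392 contains 1391"): every proof of
`DigitPolyUniformity` is in particular a proof of the (open) `QuadraticDigitPhases`, and a refutation of
`QuadraticDigitPhases` refutes `DigitPolyUniformity`.

* `quadraticDigitPhases_of_digitPolyUniformity : DigitPolyUniformity → QuadraticDigitPhases`.
-/

set_option linter.dupNamespace false -- D-0017: single-problem summit ⇒ `QuantumAdvantage.QuantumAdvantage` by design

namespace Summit.QuantumAdvantage.QuantumAdvantage.Theorems.MobiusLadder

open Filter
open Summit.QuantumAdvantage.QuantumAdvantage.Theses.MobiusLadder

/-- **`DigitPolyUniformity` implies `QuadraticDigitPhases`** (crux stmt-QuantumAdvantage-1392 contains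
crux stmt-QuantumAdvantage-1391): uniformity of `λ` against all `𝔽₂`-phases of degree `≤ (log₂ n)^A`
for every `A` gives it for degree `≤ 2`, because `2 ≤ (log₂ n)^1` for `n ≥ 4`. [folklore] -/
theorem quadraticDigitPhases_of_digitPolyUniformity :
    Summit.QuantumAdvantage.QuantumAdvantage.Theses.MobiusLadder.DigitPolyUniformity →
      Summit.QuantumAdvantage.QuantumAdvantage.Theses.MobiusLadder.QuadraticDigitPhases := by
  intro h
  unfold QuadraticDigitPhases
  intro ε hε
  have h1 := h 1 ε hε
  filter_upwards [h1, eventually_ge_atTop 4] with n hn hn4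
  intro P hP
  refine hn P (hP.trans ?_)
  rw [pow_one]
  exact Nat.le_log_of_pow_le one_lt_two (by norm_num; omega)

end Summit.QuantumAdvantage.QuantumAdvantage.Theorems.MobiusLadder
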